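import Literature.NumberTheory.Automorphic.VarmaLocalGlobalPrecIProofs
import Literature.NumberTheory.GaloisRepresentations.PstWeilDeligne
import HarnessLib

/-!
# A'Campo–Hevesi–Thorne–Whitmore 2026, Thm. 1.2.1 (Weil–Deligne clause) and Cor. 1.2.2:
# semisimplified local–global compatibility and dominated monodromy at the places `v ∣ p`

Topic `Literature/NumberTheory/Automorphic`; third sibling of `AHTW2026LocalGlobalAtP` (named fact
`AHTW2026.deRham_hodgeTateRegular 𝓓`: the de Rham and Hodge–Tate-regular clause of Thm. 1.2.1)
and `AHTW2026ExactWeights` (`AHTW2026.labelledHodgeTateWeights_eq 𝓓`: the exact weights), both of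
which record in their module docstrings that "the Weil–Deligne clause `WD(…)^{ss} ≅ ι⁻¹rec^T(π_v)^{ss}`
is NOT vendored".  It is vendored here, together with Corollary 1.2.2, in the Weil–Deligne vocabulary
and the exact statement shape of the accepted `Varma2024.theorem12_trace_eq_and_precI`
(`VarmaLocalGlobalPrecI.lean`: the same two conclusions at the places `v ∤ p`, Varma 2024 Thm. 1–2),
with the Grothendieck–Deligne relation `IsWeilDeligneOfLadic` of the `ℓ ≠ p` case replaced by the
relation `IsWeilDeligneOf` of `p`-adic Hodge data `𝓓 K p v` (intended: Fontaine's
`(B_dR(K_v), WD ∘ D_pst)`) — a PARAMETER, exactly as in the two siblings (see "Rendering").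
Requested by cite item `wi-12197` (route `Langlands/WeightVelocityMonodromy`, typed shadow
`AHTWSemisimpleLGC`).

Source read (L. A'Campo, B. Hevesi, J. A. Thorne, D. Whitmore, *Local-global compatibility of
automorphic Galois representations over CM fields at `p`*, arXiv:2607.11763 (2026); page numbers of
the held text), verbatim:

> (p. 5) 1.2. Results of this paper. — We complete the proof of Conjecture 1.1.3 for CM number
> fields `F`, by establishing semi-simplified local-global compatibility at the `p`-adic places:
> **1.2.1. Theorem.** Let `F` be a CM number field, let `n ≥ 1`, and let `ι : ℚ̄_p → ℂ` be an
> isomorphism. Let `π` be a cuspidal, regular algebraic automorphic representation of `GL_n(𝔸_F)`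
> of weight `λ`. Then for any place `v | p` of `F`, the representation `r_{π,ι}|_{G_{F_v}}` is
> de Rham of Hodge–Tate weights `HT_τ(r_{π,ι}) = {λ_{ιτ,1} + (n−1), …, λ_{ιτ,n}}`, and there is an
> isomorphism `WD(r_{π,ι}|_{G_{F_v}})^{ss} ≅ ι⁻¹ rec^T_{F_v}(π_v)^{ss}`.
> (p. 6) **1.2.2. Corollary.** In the situation of Theorem 1.2.1, we have
> `WD(r_{π,ι}|_{G_{F_v}})^{F-ss} ≺ ι⁻¹ rec^T_{F_v}(π_v)`.
> If `(r, N)` and `(r', N')` are Frobenius-semisimple Weil–Deligne representations, the relation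
> `(r, N) ≺ (r', N')`, defined in [Var24, §8], means that `N'` is 'closer to regular nilpotent
> than `N`'. We recall the definition of this relation, and explain why Theorem 1.2.1 implies
> Corollary 1.2.2, in §6 below.
> (p. 9) We write `rec^T_K` for the Tate normalisation of the local Langlands correspondence for
> `GL_n(K)` … When `Ω = ℂ`, it is related to the usual unitary normalisation by the formula
> `rec^T_K(π) = rec_K(π |·|^{(1−n)/2})`.
> (p. 111) The following is [Var24, Definition 8.2]. **6.0.2. Definition.** Let `(r, N)`,
> `(r', N')` be Frobenius-semisimple Weil–Deligne representations. We write `(r, N) ≺ (r', N')` if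
> for all `ω ∈ 𝒲`, and for all `i ≥ 1`, we have
> `m_{1,ω}(r, N) + ⋯ + m_{i,ω}(r, N) ≤ m_{1,ω}(r', N') + ⋯ + m_{i,ω}(r', N')`.
> (p. 112) **6.0.6. Corollary.** Let `n ≥ 1`, let `π` be a generic irreducible admissible
> `ℂ[GL_n(K)]`-module, and let `(r, N)` be a Weil–Deligne representation on `ℂⁿ` such that
> `(r, N)^{ss} ≅ rec_K(π)^{ss}`. Then `(r, N)^{F-ss} ≺ rec_K(π)`.

(`r_{π,ι}` is the representation of Harris–Lan–Taylor–Thorne / Scholze, p. 2; at `v | p`,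
"`WD` … is defined only under the condition that `r_v` is de Rham (equivalently, potentially
semi-stable), using a recipe of Fontaine [Fon94]", p. 4.)  Varma's bridge between `≺` and the
inertial order `≺_I` (I. Varma, arXiv:1411.2520 §9, Lemma 9.2 = Forum Math. Sigma 12 (2024) e21,
Lemma 8.4 (2) = Bellaïche–Chenevier 6.5.3), verbatim: "If `(σ', N')` is another Weil-Deligne
representation of `F_v` such that `σ^{ss} ≅ σ'^{ss}`, then
`(σ, N) ≺ (σ', N') ⇔ (σ, N) ≺_I (σ', N')`."

## Rendering (ONE named fact, D-0014; WEAKER than the source, never stronger)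

Binder for binder the accepted `Varma2024.theorem12_trace_eq_and_precI`, moved to the places
`v ∣ ℓ` (`ℓ` is the paper's `p`; `((ℓ : ℕ) : 𝓞 K) ∈ v.asIdeal`), with the `p`-adic Hodge data `𝓓`
of the accepted `AHTW2026.deRham_hodgeTateRegular 𝓓` as the extra parameter:

* `K` CM (`NumberField.IsCMField`), `1 ≤ n` as printed; `π` cuspidal regular algebraic
  (`CuspidalAutomorphicRepData n K hcpt`, `IsRegularAlgebraic`, `∀ hcpt`); `ι : ℚ̄_ℓ ≃+* ℂ`.
* `r_{π,ι}` is presented, as in all three accepted renderings (`Varma2024.corollary93_unramified`,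
  `Varma2024.theorem12_trace_eq_and_precI`, `AHTW2026.deRham_hodgeTateRegular`), as ANY continuous
  semisimple `r : Γ_K → GL_n(ℚ̄_ℓ)` with Harris–Lan–Taylor–Thorne's characterising property
  (`HarrisLanTaylorThorne2016.IsCompatible π.1 ι r`); all such `r` are conjugate to `r_{π,ι}`
  (HLTT Thm. A uniqueness + Brauer–Nesbitt) and both conclusions are isomorphism invariants
  (`PstWeilDeligneData.conj`, `WeilDeligneRep.IsEquivalent.trace_eq`, `….precI_iff_left`).
* `π_v` IS the local component: an irreducible smooth `πv` with `π.1.HasLocalComponentAt v πv.ρ`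
  (Flath), conjunctively hypothesised.
* `WD(r_{π,ι}|_{G_{F_v}})` at `v ∣ ℓ` IS Fontaine's: `W` with `(𝓓 K ℓ v hv).IsWeilDeligneOf
  (r.toLocal v) W` — for the intended datum this says precisely "`r|_{Γ_{K_v}}` is de Rham and
  `W ≅ WD(D_pst(r|_{Γ_{K_v}}))`", the condition under which the printed `WD` is defined (p. 4) —
  and `Wℂ = ι(W)` (`WeilDeligneRep.IsTransportAlong`), conjunctively hypothesised, exactly as the
  `ℓ ≠ p` file hypothesises `IsWeilDeligneOfLadic`.  The datum is a PARAMETER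
  (`𝓓 : ∀ K p v, ℓ ∈ v → PstWeilDeligneData (K_v) p`), as in both accepted AHTW siblings and in
  `Qian2022.potentialAutomorphy_ordinary` / `FontaineMazurLanglandsGLn 𝔅`: Lean has no
  construction of `WD ∘ D_pst` (the accepted pin `fontainePstAdicCompletion` fixes the period ring
  `B_dR(K_v)` but its Weil–Deligne half "remains pinned by specification", module docstring of
  `PAdicHodge/FontaineDpst`), so the printed theorem is the member of this family AT FONTAINE'S
  DATUM and consumers instantiate `𝓓` accordingly; nothing is asserted here about any datum.
* `ι⁻¹ rec^T_{F_v}(π_v)`: `rec^T_K(π) = rec_K(π|·|^{(1−n)/2})` (p. 9) is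
  `(𝓛 v).recTwist ((1 - n)/2) πv` (`LocalLanglandsDatum.recTwist`, "the Clozel / Harris–Taylor
  normalisation"), a CLASS of Frobenius-semisimple Weil–Deligne representations over `ℂ`; `S` is
  any Frobenius-semisimple representative (conclusions are class invariants,
  `Varma2024.trace_eq_of_mk_eq_mk`, `WeilDeligneRep.IsEquivalent.precI_iff_right`).  Reading the
  printed `ι⁻¹(·)` on the automorphic side as `ι(·)` on the Galois side (`Wℂ = ι(W)` compared with
  `S` over `ℂ`) is the same statement (`ι` is a field isomorphism; the Tate normalisation "is
  invariant under field automorphisms", p. 3).  **The local Langlands correspondences are bound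
  `∃ 𝓛` once per number field**, before all automorphic and Galois variables, verbatim the device
  of `Varma2024.theorem12_trace_eq_and_precI` and for the reason given there (the axioms of
  `LocalLanglandsDatum` do not pin Harris–Taylor's `rec` outright, so a `∀ 𝓛` statement would be
  STRONGER than the source); a consumer needing one normalisation simultaneously at `v ∤ ℓ`
  (Varma) and `v ∣ ℓ` (this file) — i.e. Conjecture 1.1.3 as a whole — must request that
  combined rendering, it does not follow formally from the two facts.
* Conclusion (a), **Thm. 1.2.1 (Weil–Deligne clause)** "`WD(r|_{G_{F_v}})^{ss} ≅ ι⁻¹rec^T(π_v)^{ss}`":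
  `tr Wℂ.ρ(w) = tr S.ρ(w)` for all `w ∈ W_{K_v}` — over `ℂ` (characteristic `0`) equality of
  traces of two finite-dimensional representations of a group is isomorphism of their
  semisimplifications, and (Frobenius-)semisimplification does not change traces
  (`WeilDeligneRep.IsFrobSemisimplificationOf.trace_eq`); `(·)^{ss}` forgets `N` (p. 4: "the same
  … up to 'forgetting the `N`'"), so nothing about `N` is asserted in (a).  WEAKER-or-equal.
* Conclusion (b), **Cor. 1.2.2** "`WD(r|_{G_{F_v}})^{F-ss} ≺ ι⁻¹rec^T(π_v)`": `Wℂ ≺_I S`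
  (`WeilDeligneRep.PrecI`, Varma Def. 8.3, file `WeilDeligneDominance`) — given (a), the printed
  `≺` (Def. 6.0.2 = Varma Def. 8.2) coincides with `≺_I` by Varma's Lemma 8.4 (2), and `≺_I` is
  insensitive to Frobenius-semisimplification on the left (`WeilDeligneRep.precI_congr_left` /
  `IsFrobSemisimplificationOf`), so "`WD(…)^{F-ss} ≺`" may be read on `Wℂ` itself; this is exactly
  how the accepted Varma fact renders "`WD(…)^{Frob-ss} ≺ ı⁻¹rec(…)`".  Def. 6.0.2 itself (which
  needs the classification `V[ω] ≅ ⊕ sᵢ ⊗ Sp(mᵢ)`) is not in the tree.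
* The de Rham / Hodge–Tate clauses of Thm. 1.2.1 are the two sibling facts and are not repeated.

NAMED FACT (not proved here; discharge status OPEN, size XL: degree shifting for `U(n,n)` with
torsion coefficients, `P`-ordinary Hida theory, interpolation of Bernstein-centre elements along
`Emerton`'s functor — §§2–5 of a 118-page preprint — on top of HLTT/Scholze's construction of
`r_{π,ι}`, none of which exists as theorems).

## References

* [AHTW2026] L. A'Campo, B. Hevesi, J. A. Thorne, D. Whitmore, *Local-global compatibility of
  automorphic Galois representations over CM fields at p*, arXiv:2607.11763 (2026): Thm. 1.2.1
  (p. 5), Cor. 1.2.2 (p. 6), `rec^T` (p. 9), Def. 6.0.2 (p. 111), Cor. 6.0.6 (p. 112).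
* [VarmaFMS2024] I. Varma, Forum Math. Sigma 12 (2024) e21 (arXiv:1411.2520): Def. 8.2–8.3,
  Lemma 8.4 (2) (arXiv §9: Def. 9.2–9.3, Lemma 9.2).
* [HarrisLanTaylorThorneRMS2016] M. Harris, K.-W. Lan, R. Taylor, J. Thorne, Res. Math. Sci. 3:37
  (2016), Thm. A (`r_{ℓ,ι}(π)`, uniqueness clause).
* [HarrisTaylorAMS2001] M. Harris, R. Taylor, Ann. of Math. Stud. 151 (2001), Thm. A, VII.1
  (`rec_{F_v}`).
-/

noncomputable section

open scoped MatrixGroups Matrix Classical NumberField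
open NumberField IsDedekindDomain Field Module

namespace Literature.NumberTheory.Automorphic

namespace AHTW2026

open Literature.NumberTheory.GaloisRepresentations

/-- **A'Campo–Hevesi–Thorne–Whitmore 2026, Theorem 1.2.1 (Weil–Deligne clause) and Corollary 1.2.2
(semisimplified local–global compatibility and dominated monodromy at `v ∣ ℓ`)**, NAMED FACT,
relative to `p`-adic Hodge data `𝓓 K p v` at the places `v ∣ p` of number fields (intended:
Fontaine's `(B_dR(K_v), WD ∘ D_pst)`; a parameter, see the module docstring).  Let `K` be a CM
number field.  There is a choice `𝓛 = (𝓛_v)_v` of local Langlands correspondences of the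
completions `K_v` (Harris–Taylor's `rec_{K_v}`) such that: for every `n ≥ 1`, every cuspidal
regular algebraic `π` on `GL_n(𝔸_K)`, every prime `ℓ`, `ι : ℚ̄_ℓ ≃ ℂ`, every continuous semisimple
`r : Γ_K → GL_n(ℚ̄_ℓ)` with Harris–Lan–Taylor–Thorne's property (`r ≅ r_{π,ι}`), every place
`v ∣ ℓ` of `K`, every irreducible smooth local component `πv` of `π` at `v`, every Weil–Deligne
representation `W` attached to `r|_{Γ_{K_v}}` by the datum (`IsWeilDeligneOf`: for Fontaine's datum,
"`r|_{Γ_{K_v}}` is de Rham and `W ≅ WD(D_pst(r|_{Γ_{K_v}}))`") with transport `Wℂ = ι(W)`, and every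
Frobenius-semisimple representative `S` of `rec^T_{K_v}(πv) = rec_{K_v}(πv ⊗ |det|_v^{(1-n)/2})`:
(a) `tr Wℂ.ρ(w) = tr S.ρ(w)` for all `w ∈ W_{K_v}`
("`WD(r_{π,ι}|_{G_{F_v}})^{ss} ≅ ι⁻¹ rec^T_{F_v}(π_v)^{ss}`", Thm. 1.2.1), and (b) `Wℂ ≺_I S`
("`WD(r_{π,ι}|_{G_{F_v}})^{F-ss} ≺ ι⁻¹ rec^T_{F_v}(π_v)`", Cor. 1.2.2 via Cor. 6.0.6; with Varma's
Lemma 8.4 (2): given (a), `≺ = ≺_I`, and `≺_I` ignores Frobenius-semisimplification).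
Weaker than the source (traces instead of `(·)^{ss}`-isomorphism classes, `≺_I` for `≺` given (a);
de Rham / Hodge–Tate clauses in the sibling facts). Not proved here.
[cite: AHTW2026, Thm. 1.2.1, Cor. 1.2.2, Def. 6.0.2 and Cor. 6.0.6]
[cite: VarmaFMS2024, Def. 8.2–8.3 and Lemma 8.4 (2)]
[cite: HarrisLanTaylorThorneRMS2016, Thm. A (uniqueness clause)] -/
def weilDeligne_trace_eq_and_precI
    (𝓓 : ∀ (K : Type) [Field K] [NumberField K] (p : ℕ) [Fact p.Prime]
      (v : HeightOneSpectrum (𝓞 K)), ((p : ℕ) : 𝓞 K) ∈ v.asIdeal →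
        PstWeilDeligneData (v.adicCompletion K) p) : Prop :=
  ∀ (K : Type) [Field K] [NumberField K], IsCMField K →
    ∃ 𝓛 : ∀ v : HeightOneSpectrum (𝓞 K), LocalLanglandsDatum (v.adicCompletion K),
    ∀ (n : ℕ), 1 ≤ n →
    ∀ (hcpt : isCompact_glFiniteIntegralLevel n K) (π : CuspidalAutomorphicRepData n K hcpt),
      π.1.IsRegularAlgebraic →
    ∀ (ℓ : ℕ) [Fact ℓ.Prime] (ι : PadicAlgCl ℓ ≃+* ℂ) (r : FramedGaloisRep K (PadicAlgCl ℓ) n),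
      r.toGaloisRep.IsSemisimple → HarrisLanTaylorThorne2016.IsCompatible π.1 ι r →
    ∀ (v : HeightOneSpectrum (𝓞 K)) (hv : ((ℓ : ℕ) : 𝓞 K) ∈ v.asIdeal)
      (πv : SmoothIrrep (GL (Fin n) (v.adicCompletion K))), π.1.HasLocalComponentAt v πv.ρ →
    ∀ (W : WeilDeligneRep (v.adicCompletion K) (PadicAlgCl ℓ) (Fin n → PadicAlgCl ℓ))
      (Wℂ : WeilDeligneRep (v.adicCompletion K) ℂ (Fin n → ℂ)),
      (𝓓 K ℓ v hv).IsWeilDeligneOf (r.toLocal v) W →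
      W.IsTransportAlong (ι : PadicAlgCl ℓ →+* ℂ) Wℂ →
    ∀ (S : WeilDeligneRep (v.adicCompletion K) ℂ (Fin n → ℂ)) (hS : S.IsFrobSemisimple),
      Quotient.mk (frobSemisimpleWDSetoid (v.adicCompletion K) n) ⟨S, hS⟩ =
        (𝓛 v).recTwist ((1 - (n : ℂ)) / 2) πv →
    (∀ w : WeilGroup (v.adicCompletion K),
        LinearMap.trace ℂ (Fin n → ℂ) (Wℂ.ρ w) = LinearMap.trace ℂ (Fin n → ℂ) (S.ρ w)) ∧
      Wℂ.PrecI S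

/-- **Theorem 1.2.1, Weil–Deligne clause alone** (projection of `weilDeligne_trace_eq_and_precI`,
dropping Corollary 1.2.2): for a CM field `K` there is a normalisation `𝓛` of the local Langlands
correspondences such that, in the situation of the fact, `WD(r|_{Γ_{K_v}})` read over `ℂ` through
`ι` and `rec^T_{K_v}(π_v)` have the same traces on `W_{K_v}` (= isomorphic semisimplifications).
[cite: AHTW2026, Thm. 1.2.1] -/
theorem weilDeligne_trace_eq_and_precI.trace_eq
    {𝓓 : ∀ (K : Type) [Field K] [NumberField K] (p : ℕ) [Fact p.Prime]
      (v : HeightOneSpectrum (𝓞 K)), ((p : ℕ) : 𝓞 K) ∈ v.asIdeal →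
        PstWeilDeligneData (v.adicCompletion K) p}
    (h : weilDeligne_trace_eq_and_precI 𝓓) (K : Type) [Field K] [NumberField K]
    (hK : IsCMField K) :
    ∃ 𝓛 : ∀ v : HeightOneSpectrum (𝓞 K), LocalLanglandsDatum (v.adicCompletion K),
    ∀ (n : ℕ), 1 ≤ n →
    ∀ (hcpt : isCompact_glFiniteIntegralLevel n K) (π : CuspidalAutomorphicRepData n K hcpt),
      π.1.IsRegularAlgebraic →
    ∀ (ℓ : ℕ) [Fact ℓ.Prime] (ι : PadicAlgCl ℓ ≃+* ℂ) (r : FramedGaloisRep K (PadicAlgCl ℓ) n),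
      r.toGaloisRep.IsSemisimple → HarrisLanTaylorThorne2016.IsCompatible π.1 ι r →
    ∀ (v : HeightOneSpectrum (𝓞 K)) (hv : ((ℓ : ℕ) : 𝓞 K) ∈ v.asIdeal)
      (πv : SmoothIrrep (GL (Fin n) (v.adicCompletion K))), π.1.HasLocalComponentAt v πv.ρ →
    ∀ (W : WeilDeligneRep (v.adicCompletion K) (PadicAlgCl ℓ) (Fin n → PadicAlgCl ℓ))
      (Wℂ : WeilDeligneRep (v.adicCompletion K) ℂ (Fin n → ℂ)),
      (𝓓 K ℓ v hv).IsWeilDeligneOf (r.toLocal v) W →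
      W.IsTransportAlong (ι : PadicAlgCl ℓ →+* ℂ) Wℂ →
    ∀ (S : WeilDeligneRep (v.adicCompletion K) ℂ (Fin n → ℂ)) (hS : S.IsFrobSemisimple),
      Quotient.mk (frobSemisimpleWDSetoid (v.adicCompletion K) n) ⟨S, hS⟩ =
        (𝓛 v).recTwist ((1 - (n : ℂ)) / 2) πv →
    ∀ w : WeilGroup (v.adicCompletion K),
      LinearMap.trace ℂ (Fin n → ℂ) (Wℂ.ρ w) = LinearMap.trace ℂ (Fin n → ℂ) (S.ρ w) := by
  obtain ⟨𝓛, h𝓛⟩ := h K hK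
  exact ⟨𝓛, fun n hn hcpt π hπ ℓ _ ι r hss hc v hv πv hπv W Wℂ hW hWℂ S hS hrec =>
    (h𝓛 n hn hcpt π hπ ℓ ι r hss hc v hv πv hπv W Wℂ hW hWℂ S hS hrec).1⟩

/-- **Both conclusions are invariants of the representative of `rec^T_{K_v}(π_v)`**: in the
situation of the fact, if (a) and (b) hold for one Frobenius-semisimple representative `S` of the
class `rec^T_{K_v}(πv)`, they hold for every other representative `S'` of the same class (traces:
`Varma2024.trace_eq_of_mk_eq_mk`; `≺_I`: `WeilDeligneRep.IsEquivalent.precI_iff_right`).  This is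
why the fact may quantify over ALL representatives. [cite: VarmaFMS2024, Def. 8.3 and Lemma 8.4 (2)] -/
theorem trace_eq_and_precI_of_representative
    {F : Type} [Field F] [ValuativeRel F] [TopologicalSpace F] [IsNonarchimedeanLocalField F]
    {n : ℕ} {Wℂ S S' : WeilDeligneRep F ℂ (Fin n → ℂ)}
    (hS : S.IsFrobSemisimple) (hS' : S'.IsFrobSemisimple)
    (hcl : Quotient.mk (frobSemisimpleWDSetoid F n) ⟨S, hS⟩ =
      Quotient.mk (frobSemisimpleWDSetoid F n) ⟨S', hS'⟩)
    (h : (∀ w : WeilGroup F,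
        LinearMap.trace ℂ (Fin n → ℂ) (Wℂ.ρ w) = LinearMap.trace ℂ (Fin n → ℂ) (S.ρ w)) ∧
      Wℂ.PrecI S) :
    (∀ w : WeilGroup F,
        LinearMap.trace ℂ (Fin n → ℂ) (Wℂ.ρ w) = LinearMap.trace ℂ (Fin n → ℂ) (S'.ρ w)) ∧
      Wℂ.PrecI S' := by
  have hSS' : S.IsEquivalent S' := Quotient.exact hcl
  refine ⟨fun w => ?_, ?_⟩
  · rw [h.1 w]
    exact Varma2024.trace_eq_of_mk_eq_mk hcl w
  · exact (hSS'.precI_iff_right Wℂ).1 h.2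

end AHTW2026

end Literature.NumberTheory.Automorphic

end
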